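import Summits.BirchSwinnertonDyer.Rank1Residual.Additive.SharpenedStatements
import Literature.NumberTheory.EllipticCurves.PAdicGrossZagierConstantTermProofs
import Literature.NumberTheory.EllipticCurves.ModularCurveManinSemistableCoprimeFormProofs
import Literature.AlgebraicGeometry.PlaneCurves.HessePencilHarmonicMembers
import HarnessLib

/-!
# Route `SchneiderFreeAdditiveX3` (K1 door), crux r3 `GordTwoBranchIMC` (item 19177): the `j`-INVARIANT OBSTRUCTION to good reduction
# and to the semistability index `e = 2` — kernel lemmas for the `d_K = −3` sliver's support (`stub_sliver`)

Cell `bsd-schneider-ideate`, seat `bsd-schneider-door-c5` (prover, generation 35; `--supports` 19177).  PARTITION: board row B6 ∩ X3 ∩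
sst-twist, `r = 1`, (G-ord, `e = 2`) half of `Rank1Residual.partition` — ASSEMBLY support; types-the-object-of nothing; closes nothing
(BSD NOT advanced).  bears_on: K1-door (item 19177, registered stub `stub_sliver` = `KYReadSliver`).

WHY.  After generation 34 the `d_K = −3` sliver of crux r3's record can bite only at `p ∈ {7, 19, 37, 43, 67, 163}`
(`KYBranchSliverVoidThirteen.mem_sliverPrimes_of_heegner_of_red_of_discr_eq_neg_three`), and `p = 7` carries genuine data.  On paper the
four CM primes `19, 43, 67, 163` and `37` are excluded by Mazur's table of rational isogenies (Mazur 1978, Thm. 7.1): a rational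
`p`-isogeny at these primes pins the `j`-invariant (`j = j(𝓞_{ℚ(√−p)})`, resp. the two Mazur–Swinnerton-Dyer values at `37`), and those
`j`-invariants are incompatible with the cell (at the CM primes `j_p − 1728 = −p·□`, so `v_p(Δ_min)` is ODD, while the cell's `e = 2`
means `v_p(Δ_min) ≡ 6 (mod 12)`; at `37`, `j − 1728 = −5·□` forces bad reduction at `5`, which is inert in `ℚ(√−3)`).  THIS FILE supplies
the UNCONDITIONAL arithmetic half of that argument — the valuation bookkeeping on a globally minimal model — with the six numerical
instances; the sibling `…GordCellSliverSupportSeven` adds Mazur's table as a displayed published fact and concludes `p = 7`.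

* §1 `j_sub_mul_minimalDiscriminantInt_eq` — for a globally minimal `W/ℚ`: `(j − 1728)·Δ_min = c₆(W_ℤ)²` in `ℤ`-currency (the tree's
  field identity `Literature.AlgebraicGeometry.PlaneCurves.j_sub_1728_mul_Δ` and `WeierstrassCurve.cast_integralModelInt_c₆`).
* §2 `odd_padicValInt_minimalDiscriminantInt_of_j_eq` — if `j(W) = j₀ ∈ ℤ` and `j₀ − 1728 = ℓ·m` with `ℓ ∤ m`, then `v_ℓ(Δ_min)` is odd;
  hence `ℓ ∣ Δ_min` (`dvd_minimalDiscriminantInt_of_j_eq`), `W` has BAD reduction at `ℓ` (`not_hasGoodReductionAtPrime_of_j_eq`), and the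
  census semistability index `e = 12 / gcd(12, v_ℓ(Δ_min))` is NOT `2` (`semistabilityIndex_ne_two_of_j_eq`, so `¬ SubGordTwo W ℓ`).
* §3 the instances: `j₀ = −2¹⁵·3³` (`ℓ = 19`), `−2¹⁸·3³·5³` (`43`), `−2¹⁵·3³·5³·11³` (`67`), `−2¹⁸·3³·5³·23³·29³` (`163`) — `e ≠ 2` at `ℓ`
  and bad reduction at `ℓ`; `j₀ ∈ {−7·11³, −7·137³·2083³}` — bad reduction at `5`.

HONEST FRAMING: every statement here is an UNCONDITIONAL elementary theorem about Weierstrass equations over `ℚ` (no named fact, no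
definition, no `sorry`); nothing is asserted about isogenies, Iwasawa theory or BSD; the crux 19177 stays OPEN; «closes rung: none».
References: Silverman, *AEC* III.1 (`c₄³ − c₆² = 1728Δ`, `j = c₄³/Δ`), VII.1.3(b), VII.5.1(a), VIII.8 [SilvermanAEC2009]; Cox, *Primes of the
form x² + ny²* §12.C (12.20) (the class-number-one singular moduli) [Cox2013]; Mazur, Invent. Math. 44 (1978) Thm. 7.1 and the table of the
introduction (context only) [Mazur1978].
-/

set_option autoImplicit false
-- `Summit.<P>.<Sub>` repeats `BirchSwinnertonDyer` by the tree's layout convention (D-0017)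
set_option linter.dupNamespace false

noncomputable section

open scoped Classical

open WeierstrassCurve Literature.NumberTheory.EllipticCurves Literature.NumberTheory.EllipticCurves.Rank1Residual
  Summit.BirchSwinnertonDyer.Rank1Residual

namespace Summit.BirchSwinnertonDyer.BirchSwinnertonDyer.Theorems.SchneiderFreeAdditiveX3.JInvariantObstruction

/-! ### §1 `(j − 1728)·Δ_min = c₆(W_ℤ)²` on a globally minimal model -/

/-- **`(j − 1728)·Δ_min = c₆(W_ℤ)²`** for a globally minimal elliptic curve `W/ℚ` (both sides read in `ℚ`).
[cite: SilvermanAEC2009, III.1 and VIII.8 (minimal discriminant)] -/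
theorem j_sub_mul_minimalDiscriminantInt_eq (W : WeierstrassCurve ℚ) [W.IsElliptic] [W.IsGloballyMinimal] :
    (W.j - 1728) * (minimalDiscriminantInt W : ℚ) = (((integralModelInt W).c₆ : ℤ) : ℚ) ^ 2 := by
  rw [cast_minimalDiscriminantInt, cast_integralModelInt_c₆]
  exact Literature.AlgebraicGeometry.PlaneCurves.j_sub_1728_mul_Δ W

/-- **Integral identity.**  If `j(W) = j₀ ∈ ℤ` then `(j₀ − 1728)·Δ_min = c₆(W_ℤ)²` in `ℤ`. [cite: SilvermanAEC2009, III.1 and VIII.8] -/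
theorem int_j_sub_mul_minimalDiscriminantInt_eq (W : WeierstrassCurve ℚ) [W.IsElliptic] [W.IsGloballyMinimal] {j₀ : ℤ}
    (hj : W.j = (j₀ : ℚ)) : (j₀ - 1728) * minimalDiscriminantInt W = (integralModelInt W).c₆ ^ 2 := by
  have h := j_sub_mul_minimalDiscriminantInt_eq W
  rw [hj] at h
  exact_mod_cast h

/-! ### §2 `v_ℓ(j − 1728)` odd ⟹ `v_ℓ(Δ_min)` odd ⟹ bad reduction at `ℓ` and `e ≠ 2` -/

/-- **The `j`-invariant obstruction (valuation form).**  Let `W/ℚ` be a globally minimal elliptic curve with `j(W) = j₀ ∈ ℤ`, and let `ℓ` be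
a prime with `j₀ − 1728 = ℓ·m`, `ℓ ∤ m` (i.e. `v_ℓ(j₀ − 1728) = 1`).  Then `v_ℓ(Δ_min(W))` is ODD: from `(j₀ − 1728)·Δ_min = c₆²`,
`1 + v_ℓ(Δ_min) = 2·v_ℓ(c₆)`.  UNCONDITIONAL. [cite: SilvermanAEC2009, III.1 and VII.1 Prop. 1.3(b)] -/
theorem odd_padicValInt_minimalDiscriminantInt_of_j_eq {ℓ : ℕ} [hℓ : Fact ℓ.Prime] (W : WeierstrassCurve ℚ) [W.IsElliptic]
    [W.IsGloballyMinimal] {j₀ m : ℤ} (hj : W.j = (j₀ : ℚ)) (hfac : j₀ - 1728 = ℓ * m) (hm : ¬ (ℓ : ℤ) ∣ m) :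
    Odd (padicValInt ℓ (minimalDiscriminantInt W)) := by
  have hD : minimalDiscriminantInt W ≠ 0 := minimalDiscriminantInt_ne_zero W
  have hℓ0 : (ℓ : ℤ) ≠ 0 := Int.natCast_ne_zero.mpr hℓ.out.ne_zero
  have hm0 : m ≠ 0 := by rintro rfl; exact hm (dvd_zero _)
  have key : (ℓ : ℤ) * m * minimalDiscriminantInt W = (integralModelInt W).c₆ * (integralModelInt W).c₆ := by
    rw [← hfac, ← pow_two]; exact int_j_sub_mul_minimalDiscriminantInt_eq W hj
  have hc0 : (integralModelInt W).c₆ ≠ 0 := by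
    intro h0
    rw [h0, mul_zero] at key
    exact mul_ne_zero (mul_ne_zero hℓ0 hm0) hD key
  have hv := congrArg (padicValInt ℓ) key
  rw [padicValInt.mul (mul_ne_zero hℓ0 hm0) hD, padicValInt.mul hℓ0 hm0, padicValInt.mul hc0 hc0, padicValInt_self,
    padicValInt.eq_zero_of_not_dvd hm] at hv
  exact ⟨padicValInt ℓ (integralModelInt W).c₆ - 1, by omega⟩

/-- Under the same hypotheses `ℓ ∣ Δ_min(W)`. [cite: SilvermanAEC2009, VII.1 Prop. 1.3(b)] -/
theorem dvd_minimalDiscriminantInt_of_j_eq {ℓ : ℕ} [Fact ℓ.Prime] (W : WeierstrassCurve ℚ) [W.IsElliptic] [W.IsGloballyMinimal]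
    {j₀ m : ℤ} (hj : W.j = (j₀ : ℚ)) (hfac : j₀ - 1728 = ℓ * m) (hm : ¬ (ℓ : ℤ) ∣ m) :
    (ℓ : ℤ) ∣ minimalDiscriminantInt W := by
  obtain ⟨k, hk⟩ := odd_padicValInt_minimalDiscriminantInt_of_j_eq W hj hfac hm
  have h1 : 1 ≤ padicValInt ℓ (minimalDiscriminantInt W) := by omega
  have h := (padicValInt_dvd_iff 1 (minimalDiscriminantInt W)).mpr (Or.inr h1)
  rwa [pow_one] at h

/-- **Under the same hypotheses `W` has BAD reduction at `ℓ`** (good reduction of a globally minimal equation means `ℓ ∤ Δ_min`).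
[cite: SilvermanAEC2009, VII.5 Prop. 5.1(a) and VII.1 Prop. 1.3(b)] -/
theorem not_hasGoodReductionAtPrime_of_j_eq {ℓ : ℕ} [Fact ℓ.Prime] (W : WeierstrassCurve ℚ) [W.IsElliptic] [W.IsGloballyMinimal]
    {j₀ m : ℤ} (hj : W.j = (j₀ : ℚ)) (hfac : j₀ - 1728 = ℓ * m) (hm : ¬ (ℓ : ℤ) ∣ m) :
    ¬ W.HasGoodReductionAtPrime ℓ := fun hgood =>
  not_dvd_minimalDiscriminantInt_of_hasGoodReductionAtPrime (W := W) ℓ hgood (dvd_minimalDiscriminantInt_of_j_eq W hj hfac hm)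

/-- `12 / gcd(12, v) ≠ 2` for odd `v` (the quotient is `12` or `4`). [folklore] -/
theorem twelve_div_gcd_ne_two_of_odd {v : ℕ} (hv : Odd v) : 12 / Nat.gcd 12 v ≠ 2 := by
  set g := Nat.gcd 12 v with hg
  have hg12 : g ∣ 12 := Nat.gcd_dvd_left 12 v
  have hgv : g ∣ v := Nat.gcd_dvd_right 12 v
  have hg2 : ¬ 2 ∣ g := by
    intro h2
    obtain ⟨k, hk⟩ := hv
    have := h2.trans hgv
    omega
  have hgle : g ≤ 12 := Nat.le_of_dvd (by norm_num) hg12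
  interval_cases g <;> omega

/-- **Under the same hypotheses the census semistability index at `ℓ` is not `2`**: `e = 12 / gcd(12, v_ℓ(Δ_min))` with `v_ℓ(Δ_min)` odd
is `12` or `4`, never `2` (the cell's `e = 2` is Kodaira `I₀*`, `v_ℓ(Δ_min) = 6`).  Hence `¬ SubGordTwo W ℓ` (next lemma).
[cite: SilvermanAEC2009, VII.1 Prop. 1.3(b)] -/
theorem semistabilityIndex_ne_two_of_j_eq {ℓ : ℕ} [Fact ℓ.Prime] (W : WeierstrassCurve ℚ) [W.IsElliptic] [W.IsGloballyMinimal]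
    {j₀ m : ℤ} (hj : W.j = (j₀ : ℚ)) (hfac : j₀ - 1728 = ℓ * m) (hm : ¬ (ℓ : ℤ) ∣ m) :
    Additive.semistabilityIndex W ℓ ≠ 2 := by
  unfold Additive.semistabilityIndex
  exact twelve_div_gcd_ne_two_of_odd (odd_padicValInt_minimalDiscriminantInt_of_j_eq W hj hfac hm)

/-- Under the same hypotheses `(W, ℓ)` is NOT on the census cell (G-ord, `e = 2`). [folklore] -/
theorem not_subGordTwo_of_j_eq {ℓ : ℕ} [Fact ℓ.Prime] (W : WeierstrassCurve ℚ) [W.IsElliptic] [W.IsGloballyMinimal]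
    {j₀ m : ℤ} (hj : W.j = (j₀ : ℚ)) (hfac : j₀ - 1728 = ℓ * m) (hm : ¬ (ℓ : ℤ) ∣ m) :
    ¬ Additive.SubGordTwo W ℓ := fun h =>
  semistabilityIndex_ne_two_of_j_eq W hj hfac hm h.2

/-! ### §3 The six instances: the class-number-one CM moduli at `19, 43, 67, 163` and the two `X₀(37)` moduli at `5` -/

/-- `j = −2¹⁵·3³ = −884736` (`= j(𝓞_{ℚ(√−19)})`): `j − 1728 = −2⁶·3⁶·19`, so on a globally minimal `W/ℚ` with this `j`-invariant
`v₁₉(Δ_min)` is odd — `e ≠ 2` at `19` and bad reduction at `19`. [cite: Cox2013, §12.C (12.20)] -/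
theorem semistabilityIndex_ne_two_nineteen_of_j_eq (W : WeierstrassCurve ℚ) [W.IsElliptic] [W.IsGloballyMinimal]
    [Fact (Nat.Prime 19)] (hj : W.j = -884736) :
    Additive.semistabilityIndex W 19 ≠ 2 ∧ ¬ W.HasGoodReductionAtPrime 19 := by
  have hj' : W.j = ((-884736 : ℤ) : ℚ) := by rw [hj]; norm_num
  have hfac : (-884736 : ℤ) - 1728 = (19 : ℕ) * (-46656 : ℤ) := by norm_num
  have hm : ¬ ((19 : ℕ) : ℤ) ∣ (-46656 : ℤ) := by omega
  exact ⟨semistabilityIndex_ne_two_of_j_eq W hj' hfac hm, not_hasGoodReductionAtPrime_of_j_eq W hj' hfac hm⟩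

/-- `j = −2¹⁸·3³·5³ = −884736000` (`= j(𝓞_{ℚ(√−43)})`): `j − 1728 = −2⁶·3⁸·7²·43`, so `v₄₃(Δ_min)` is odd — `e ≠ 2` at `43` and bad
reduction at `43`. [cite: Cox2013, §12.C (12.20)] -/
theorem semistabilityIndex_ne_two_fortyThree_of_j_eq (W : WeierstrassCurve ℚ) [W.IsElliptic] [W.IsGloballyMinimal]
    [Fact (Nat.Prime 43)] (hj : W.j = -884736000) :
    Additive.semistabilityIndex W 43 ≠ 2 ∧ ¬ W.HasGoodReductionAtPrime 43 := by
  have hj' : W.j = ((-884736000 : ℤ) : ℚ) := by rw [hj]; norm_num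
  have hfac : (-884736000 : ℤ) - 1728 = (43 : ℕ) * (-20575296 : ℤ) := by norm_num
  have hm : ¬ ((43 : ℕ) : ℤ) ∣ (-20575296 : ℤ) := by omega
  exact ⟨semistabilityIndex_ne_two_of_j_eq W hj' hfac hm, not_hasGoodReductionAtPrime_of_j_eq W hj' hfac hm⟩

/-- `j = −2¹⁵·3³·5³·11³ = −147197952000` (`= j(𝓞_{ℚ(√−67)})`): `j − 1728 = −2⁶·3⁶·7²·31²·67`, so `v₆₇(Δ_min)` is odd — `e ≠ 2` at
`67` and bad reduction at `67`. [cite: Cox2013, §12.C (12.20)] -/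
theorem semistabilityIndex_ne_two_sixtySeven_of_j_eq (W : WeierstrassCurve ℚ) [W.IsElliptic] [W.IsGloballyMinimal]
    [Fact (Nat.Prime 67)] (hj : W.j = -147197952000) :
    Additive.semistabilityIndex W 67 ≠ 2 ∧ ¬ W.HasGoodReductionAtPrime 67 := by
  have hj' : W.j = ((-147197952000 : ℤ) : ℚ) := by rw [hj]; norm_num
  have hfac : (-147197952000 : ℤ) - 1728 = (67 : ℕ) * (-2196984384 : ℤ) := by norm_num
  have hm : ¬ ((67 : ℕ) : ℤ) ∣ (-2196984384 : ℤ) := by omega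
  exact ⟨semistabilityIndex_ne_two_of_j_eq W hj' hfac hm, not_hasGoodReductionAtPrime_of_j_eq W hj' hfac hm⟩

/-- `j = −2¹⁸·3³·5³·23³·29³ = −262537412640768000` (`= j(𝓞_{ℚ(√−163)})`): `j − 1728 = −2⁶·3⁶·7²·11²·19²·127²·163`, so
`v₁₆₃(Δ_min)` is odd — `e ≠ 2` at `163` and bad reduction at `163`. [cite: Cox2013, §12.C (12.20)] -/
theorem semistabilityIndex_ne_two_oneSixtyThree_of_j_eq (W : WeierstrassCurve ℚ) [W.IsElliptic] [W.IsGloballyMinimal]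
    [Fact (Nat.Prime 163)] (hj : W.j = -262537412640768000) :
    Additive.semistabilityIndex W 163 ≠ 2 ∧ ¬ W.HasGoodReductionAtPrime 163 := by
  have hj' : W.j = ((-262537412640768000 : ℤ) : ℚ) := by rw [hj]; norm_num
  have hfac : (-262537412640768000 : ℤ) - 1728 = (163 : ℕ) * (-1610658973256256 : ℤ) := by norm_num
  have hm : ¬ ((163 : ℕ) : ℤ) ∣ (-1610658973256256 : ℤ) := by omega
  exact ⟨semistabilityIndex_ne_two_of_j_eq W hj' hfac hm, not_hasGoodReductionAtPrime_of_j_eq W hj' hfac hm⟩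

/-- **The two `X₀(37)` moduli force bad reduction at `5`.**  `j = −7·11³ = −9317` has `j − 1728 = −5·47²`, and
`j = −7·137³·2083³ = −162677523113838677` has `j − 1728 = −5·11²·1433²·11443²`; so every globally minimal `W/ℚ` with either
`j`-invariant has `v₅(Δ_min)` odd, in particular BAD reduction at `5` (the minimal twists are Cremona's `1225h1`, `1225h2`, `N = 5²·7²`).
[cite: Zywina2015, Thm. 1.10 (ℓ = 37) and §4.8] [cite: SilvermanAEC2009, VII.5 Prop. 5.1(a)] -/
theorem not_hasGoodReductionAtPrime_five_of_j_eq_thirtySeven (W : WeierstrassCurve ℚ) [W.IsElliptic] [W.IsGloballyMinimal]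
    [Fact (Nat.Prime 5)] (hj : W.j = -7 * 11 ^ 3 ∨ W.j = -7 * 137 ^ 3 * 2083 ^ 3) :
    ¬ W.HasGoodReductionAtPrime 5 := by
  rcases hj with hj | hj
  · have hj' : W.j = ((-9317 : ℤ) : ℚ) := by rw [hj]; norm_num
    have hfac : (-9317 : ℤ) - 1728 = (5 : ℕ) * (-2209 : ℤ) := by norm_num
    have hm : ¬ ((5 : ℕ) : ℤ) ∣ (-2209 : ℤ) := by omega
    exact not_hasGoodReductionAtPrime_of_j_eq W hj' hfac hm
  · have hj' : W.j = ((-162677523113838677 : ℤ) : ℚ) := by rw [hj]; norm_num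
    have hfac : (-162677523113838677 : ℤ) - 1728 = (5 : ℕ) * (-32535504622768081 : ℤ) := by norm_num
    have hm : ¬ ((5 : ℕ) : ℤ) ∣ (-32535504622768081 : ℤ) := by omega
    exact not_hasGoodReductionAtPrime_of_j_eq W hj' hfac hm

end Summit.BirchSwinnertonDyer.BirchSwinnertonDyer.Theorems.SchneiderFreeAdditiveX3.JInvariantObstruction

end
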